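import Mathlib
import HarnessLib
import Summits.Ventures.LatticeQCDFlow.Scoring.GreenKuboCrossCovariance
import Summits.Ventures.LatticeQCDFlow.Scoring.DoeblinPowerGeometricEnvelope
import Summits.Ventures.LatticeQCDFlow.Scoring.MultivariateCLT
import Summits.Ventures.LatticeQCDFlow.Scoring.CramerWoldDevice
import Summits.Ventures.LatticeQCDFlow.Exactness.NCMCGeneralSpaceDoeblinPowerCLT

/-!
# THE MULTIVARIATE MARKOV-CHAIN CLT under a Doeblin power, from any initial law: for finitely many
# bounded observables the vector of scaled centred sums converges in distribution to the centred
# multivariate Gaussian whose covariance MATRIX is the long-run covariance matrix `Σ_ij = σ_{f_i f_j}`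

HONEST FRAMING: exact (Metropolis-corrected) sampling algorithms for lattice gauge theory;
figures of merit are autocorrelation/cost numbers at stated couplings and volumes; no
continuum-physics claim.

Venture `LatticeQCDFlow` (cell pub-lqcd), topic `Scoring`; FANOUT row 8 (`s0-cpn-nemc`, GEN-22).
NEW WORK of the cell, not a published result; no definition is introduced; nothing is cited as a
fact.  `Scoring/MarkovChainBivariateCLT.lean` did two observables with an explicit 2D Cholesky
pair; this file does any finite family `f : ι → (Ω → ℝ)` (`ι` a `Fintype`) with Mathlib's
multivariate Gaussian `ProbabilityTheory.multivariateGaussian 0 Σ` on `EuclideanSpace ℝ ι` as the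
limit law.  (i) The Green–Kubo variance of a finite linear combination is the QUADRATIC FORM of the
long-run covariance matrix: `σ²_{Σ t_i f_i} = Σ_{i,j} t_i t_j σ_{f_i f_j} = t ⬝ᵥ Σ *ᵥ t`
(`σ_{fg}` as in `Scoring/GreenKuboCrossCovariance.lean`; under the geometric envelope all series
converge).  (ii) Hence `Σ` is symmetric positive semidefinite (`Matrix.PosSemidef`), so
`multivariateGaussian 0 Σ` is the Gaussian measure with covariance `Σ`
(`covarianceBilin_multivariateGaussian`), and `⟪t, ·⟫` under it is `N(0, t ⬝ᵥ Σ *ᵥ t)`.  (iii) Row 13's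
one-dimensional CLT under a Doeblin power `(nHit κ m)(z,·) ≥ ε ν` from ANY initial law, applied to
`Σ t_i f_i`, and the Cramér–Wold device (`Scoring/CramerWoldDevice.lean`) give the JOINT convergence
of `((√n)⁻¹ Σ_{s<n} f̄_i(X_s))_{i∈ι}` to `multivariateGaussian 0 Σ`.  Printed counterparts NAMED
ONLY: the multivariate Markov-chain CLT and multivariate output analysis (Meyn–Tweedie 1993 §17;
Vats–Flegal–Jones 2019), nothing cited as a fact.

## Content (`f̄_i = f_i − πf_i`; `Σ = Matrix.of (i, j ↦ σ_{f_i f_j})`; `P_{μ₀}` the path law)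

* (private) `kop_finset_sum`, `iterate_kop_const_mul`, `iterate_kop_finset_sum` —
  `(kop κ)^[k] (Σ_i t_i g_i) = Σ_i t_i (kop κ)^[k] g_i` (public copies live in row 13's
  `Exactness/NCMCGeneralSpaceReplicaProductChain{TStatistic,PooledCLT}.lean`);
  `inner_toLp_euclidean` (`⟪t, toLp 2 v⟫ = Σ_i t_i v_i`);
* **`greenKubo_finset_sum_eq_of_envelope`** — `σ²_{Σ t_i f_i} = Σ_i Σ_j t_i t_j σ_{f_i f_j}`;
* `greenKubo_finset_sum_eq_dotProduct_of_envelope` — `… = t ⬝ᵥ Σ *ᵥ t`;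
* **`longRunCovMatrix_posSemidef_of_envelope`** — `Σ.PosSemidef`;
* `hasLaw_inner_multivariateGaussian_dotProduct` — `⟪t, ·⟫ ~ N(0, t ⬝ᵥ S *ᵥ t)` under `multivariateGaussian 0 S`
  for any positive semidefinite `S`;
* **`chain_multivariate_clt_of_nHit`** — THE MULTIVARIATE CLT:
  `TendstoInDistribution (fun n x => toLp 2 (fun i => (√n)⁻¹ Σ_{s<n} f̄_i(x_s))) atTop id P_{μ₀}
  (multivariateGaussian 0 Σ)`.

NOT CLAIMED: a rate; unbounded observables; infinite families; any number of ours.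
-/

noncomputable section

namespace Summit.Ventures.LatticeQCDFlow.Scoring

open MeasureTheory ProbabilityTheory Filter Finset Preorder WithLp
open scoped ENNReal Topology RealInnerProductSpace Matrix

variable {Ω : Type*} [MeasurableSpace Ω] {ι : Type*} [Fintype ι]

/-! ### The transition operator on finite sums -/

section Operator

variable (κ : Kernel Ω Ω) [IsMarkovKernel κ]

/-- `kop κ (Σ_i g_i) = Σ_i kop κ g_i` for bounded measurable `g_i`. -/
private theorem kop_finset_sum {g : ι → Ω → ℝ} (hg : ∀ i, Measurable (g i)) {C : ℝ}
    (hC : ∀ i x, |g i x| ≤ C) :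
    kop κ (fun y => ∑ i, g i y) = fun y => ∑ i, kop κ (g i) y := by
  funext y
  unfold kop
  exact integral_finsetSum _ fun i _ => integrable_of_bounded _ (hg i) (hC i)

omit [IsMarkovKernel κ] in
/-- `(kop κ)^[k] (c g) = c (kop κ)^[k] g`. -/
private theorem iterate_kop_const_mul (c : ℝ) (g : Ω → ℝ) :
    ∀ k : ℕ, (kop κ)^[k] (fun y => c * g y) = fun y => c * (kop κ)^[k] g y := by
  intro k
  induction k with
  | zero => rfl
  | succ k ih =>
    rw [Function.iterate_succ_apply', ih, kop_const_mul, Function.iterate_succ_apply']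

/-- `(kop κ)^[k] (Σ_i t_i g_i) = Σ_i t_i (kop κ)^[k] g_i` for bounded measurable `g_i`. -/
private theorem iterate_kop_finset_sum {g : ι → Ω → ℝ} (hg : ∀ i, Measurable (g i)) {C : ℝ}
    (hC : ∀ i x, |g i x| ≤ C) (t : ι → ℝ) :
    ∀ k : ℕ, (kop κ)^[k] (fun y => ∑ i, t i * g i y) = fun y => ∑ i, t i * (kop κ)^[k] (g i) y := by
  intro k
  induction k with
  | zero => rfl
  | succ k ih =>
    have hgk : ∀ i, Measurable ((kop κ)^[k] (g i)) ∧ ∀ x, |(kop κ)^[k] (g i) x| ≤ C := fun i =>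
      iterate_kop_bounded_measurable κ (hg i) (hC i) k
    rw [Function.iterate_succ_apply', ih]
    have h := kop_finset_sum κ (g := fun i y => t i * (kop κ)^[k] (g i) y)
      (fun i => (hgk i).1.const_mul _) (C := (∑ i, |t i|) * |C| + |C|) (fun i x => by
        rw [abs_mul]
        have h1 : |t i| ≤ ∑ j, |t j| := Finset.single_le_sum (fun j _ => abs_nonneg (t j))
          (Finset.mem_univ i)
        have h2 : |(kop κ)^[k] (g i) x| ≤ |C| := ((hgk i).2 x).trans (le_abs_self C)
        nlinarith [abs_nonneg (t i), abs_nonneg ((kop κ)^[k] (g i) x),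
          Finset.sum_nonneg (fun j (_ : j ∈ Finset.univ) => abs_nonneg (t j)), abs_nonneg C])
    rw [h]
    funext y
    refine Finset.sum_congr rfl fun i _ => ?_
    rw [kop_const_mul, Function.iterate_succ_apply']

end Operator

/-! ### The Green–Kubo variance of a finite linear combination -/

section QuadraticForm

variable {κ : Kernel Ω Ω} [IsMarkovKernel κ] {π : Measure Ω} [IsProbabilityMeasure π] {A ρ : ℝ}

/-- **`σ²_{Σ t_i f_i} = Σ_i Σ_j t_i t_j σ_{f_i f_j}`** under the geometric envelope (`0 ≤ ρ < 1`;
`f_i` measurable with a common bound `C`). -/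
theorem greenKubo_finset_sum_eq_of_envelope
    (henv : ∀ (g : Ω → ℝ), Measurable g → ∀ (Cg : ℝ), (∀ x, |g x| ≤ Cg) →
      ∀ (t : ℕ) (x : Ω), |(kop κ)^[t] g x - ∫ y, g y ∂π| ≤ 2 * Cg * (A * ρ ^ t))
    (hρ0 : 0 ≤ ρ) (hρ1 : ρ < 1) {f : ι → Ω → ℝ} (hf : ∀ i, Measurable (f i)) {C : ℝ}
    (hC : ∀ i x, |f i x| ≤ C) (t : ι → ℝ) :
    ((∫ y, ((∑ i, t i * f i y) - ∫ z, (∑ i, t i * f i z) ∂π) ^ 2 ∂π)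
        + 2 * ∑' k, ∫ y, ((∑ i, t i * f i y) - ∫ z, (∑ i, t i * f i z) ∂π)
          * (kop κ)^[k + 1] (fun y => (∑ i, t i * f i y) - ∫ z, (∑ i, t i * f i z) ∂π) y ∂π)
      = ∑ i, ∑ j, t i * t j * ((∫ y, (f i y - ∫ z, f i z ∂π) * (f j y - ∫ z, f j z ∂π) ∂π)
                + ∑' k, ((∫ y, (f i y - ∫ z, f i z ∂π)
                    * (kop κ)^[k + 1] (fun y => f j y - ∫ z, f j z ∂π) y ∂π)
                  + ∫ y, (f j y - ∫ z, f j z ∂π)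
                      * (kop κ)^[k + 1] (fun y => f i y - ∫ z, f i z ∂π) y ∂π)) := by
  -- centred observables and their bounds
  have hfb : ∀ i, Measurable (fun y => f i y - ∫ z, f i z ∂π) := fun i =>
    (centred_observable_bounds π (hf i) (hC i)).1
  have hCfb : ∀ i y, |f i y - ∫ z, f i z ∂π| ≤ 2 * C := fun i =>
    (centred_observable_bounds π (hf i) (hC i)).2.1
  -- the centring of the combination
  have hch : ∫ z, (∑ i, t i * f i z) ∂π = ∑ i, t i * ∫ z, f i z ∂π := by
    rw [integral_finsetSum _ fun i _ => (integrable_of_bounded π (hf i) (hC i)).const_mul _]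
    exact Finset.sum_congr rfl fun i _ => integral_const_mul _ _
  have hfun : (fun y => (∑ i, t i * f i y) - ∫ z, (∑ i, t i * f i z) ∂π)
      = fun y => ∑ i, t i * (f i y - ∫ z, f i z ∂π) := by
    funext y; rw [hch, ← Finset.sum_sub_distrib]
    exact Finset.sum_congr rfl fun i _ => by ring
  have hK : ∀ k, (kop κ)^[k] (fun y => (∑ i, t i * f i y) - ∫ z, (∑ i, t i * f i z) ∂π)
      = fun y => ∑ i, t i * (kop κ)^[k] (fun y => f i y - ∫ z, f i z ∂π) y := fun k => by
    rw [hfun]; exact iterate_kop_finset_sum κ hfb hCfb t k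
  have hKb : ∀ k i, Measurable ((kop κ)^[k] (fun y => f i y - ∫ z, f i z ∂π)) ∧
      ∀ x, |(kop κ)^[k] (fun y => f i y - ∫ z, f i z ∂π) x| ≤ 2 * C := fun k i =>
    iterate_kop_bounded_measurable κ (hfb i) (hCfb i) k
  -- integrability of the pair products
  have hint : ∀ k i j, Integrable (fun y => (f i y - ∫ z, f i z ∂π)
      * (kop κ)^[k] (fun y => f j y - ∫ z, f j z ∂π) y) π := fun k i j =>
    integrable_of_bounded π ((hfb i).mul (hKb k j).1) (C := |2 * C| * (2 * C)) fun y => by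
      rw [abs_mul]
      exact mul_le_mul ((hCfb i y).trans (le_abs_self _)) ((hKb k j).2 y) (abs_nonneg _)
        (abs_nonneg _)
  -- the lag-`k` term as a double sum (lag `0` included: `(kop κ)^[0] = id`)
  have hlag : ∀ k, ∫ y, ((∑ i, t i * f i y) - ∫ z, (∑ i, t i * f i z) ∂π)
        * (kop κ)^[k] (fun y => (∑ i, t i * f i y) - ∫ z, (∑ i, t i * f i z) ∂π) y ∂π
      = ∑ i, ∑ j, t i * t j * ∫ y, (f i y - ∫ z, f i z ∂π)
          * (kop κ)^[k] (fun y => f j y - ∫ z, f j z ∂π) y ∂π := by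
    intro k
    rw [hK k]
    have e : ∀ y, ((∑ i, t i * f i y) - ∫ z, (∑ i, t i * f i z) ∂π)
        * (fun y => ∑ j, t j * (kop κ)^[k] (fun y => f j y - ∫ z, f j z ∂π) y) y
        = ∑ i, ∑ j, t i * t j * ((f i y - ∫ z, f i z ∂π)
            * (kop κ)^[k] (fun y => f j y - ∫ z, f j z ∂π) y) := by
      intro y
      have hy := congrFun hfun y
      simp only [] at hy ⊢
      rw [hy, Finset.sum_mul_sum]
      refine Finset.sum_congr rfl fun i _ => Finset.sum_congr rfl fun j _ => by ring
    rw [integral_congr_ae (ae_of_all _ e), integral_finsetSum _ fun i _ =>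
      integrable_finsetSum _ fun j _ => (hint k i j).const_mul _]
    refine Finset.sum_congr rfl fun i _ => ?_
    rw [integral_finsetSum _ fun j _ => (hint k i j).const_mul _]
    exact Finset.sum_congr rfl fun j _ => integral_const_mul _ _
  -- lag zero: the square
  have h0 : ∫ y, ((∑ i, t i * f i y) - ∫ z, (∑ i, t i * f i z) ∂π) ^ 2 ∂π
      = ∑ i, ∑ j, t i * t j * ∫ y, (f i y - ∫ z, f i z ∂π) * (f j y - ∫ z, f j z ∂π) ∂π := by
    have h := hlag 0
    simp only [Function.iterate_zero, id_eq] at h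
    rw [← h]
    exact integral_congr_ae (ae_of_all _ fun y => by ring)
  -- the series, summed termwise
  have hs : ∀ i j, Summable fun k : ℕ => ∫ y, (f i y - ∫ z, f i z ∂π)
      * (kop κ)^[k + 1] (fun y => f j y - ∫ z, f j z ∂π) y ∂π := fun i j =>
    summable_crossAutocov_of_envelope henv hρ0 hρ1 (hf i) (hf j) (hC i) (hC j)
  have hser : ∑' k, ∫ y, ((∑ i, t i * f i y) - ∫ z, (∑ i, t i * f i z) ∂π)
        * (kop κ)^[k + 1] (fun y => (∑ i, t i * f i y) - ∫ z, (∑ i, t i * f i z) ∂π) y ∂π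
      = ∑ i, ∑ j, t i * t j * ∑' k, ∫ y, (f i y - ∫ z, f i z ∂π)
          * (kop κ)^[k + 1] (fun y => f j y - ∫ z, f j z ∂π) y ∂π := by
    rw [tsum_congr fun k => hlag (k + 1)]
    rw [Summable.tsum_finsetSum fun i _ => summable_sum fun j _ => (hs i j).mul_left _]
    refine Finset.sum_congr rfl fun i _ => ?_
    rw [Summable.tsum_finsetSum fun j _ => (hs i j).mul_left _]
    exact Finset.sum_congr rfl fun j _ => tsum_mul_left
  rw [h0, hser]
  -- assemble: `Σ_ij t_i t_j (c⁰_ij + Σ' (c_ij + c_ji)) = Σ_ij t_i t_j c⁰_ij + 2 Σ_ij t_i t_j Σ' c_ij`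
  have hsym : ∑ i, ∑ j, t i * t j * ∑' k, ∫ y, (f j y - ∫ z, f j z ∂π)
        * (kop κ)^[k + 1] (fun y => f i y - ∫ z, f i z ∂π) y ∂π
      = ∑ i, ∑ j, t i * t j * ∑' k, ∫ y, (f i y - ∫ z, f i z ∂π)
        * (kop κ)^[k + 1] (fun y => f j y - ∫ z, f j z ∂π) y ∂π := by
    rw [Finset.sum_comm]
    exact Finset.sum_congr rfl fun i _ => Finset.sum_congr rfl fun j _ => by ring
  have hsplit : ∀ i j, t i * t j * ((∫ y, (f i y - ∫ z, f i z ∂π) * (f j y - ∫ z, f j z ∂π) ∂π)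
              + ∑' k, ((∫ y, (f i y - ∫ z, f i z ∂π)
                  * (kop κ)^[k + 1] (fun y => f j y - ∫ z, f j z ∂π) y ∂π)
                + ∫ y, (f j y - ∫ z, f j z ∂π)
                    * (kop κ)^[k + 1] (fun y => f i y - ∫ z, f i z ∂π) y ∂π))
      = t i * t j * ∫ y, (f i y - ∫ z, f i z ∂π) * (f j y - ∫ z, f j z ∂π) ∂π
        + t i * t j * ∑' k, ∫ y, (f i y - ∫ z, f i z ∂π)
            * (kop κ)^[k + 1] (fun y => f j y - ∫ z, f j z ∂π) y ∂π
        + t i * t j * ∑' k, ∫ y, (f j y - ∫ z, f j z ∂π)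
            * (kop κ)^[k + 1] (fun y => f i y - ∫ z, f i z ∂π) y ∂π := by
    intro i j
    rw [(hs i j).tsum_add (hs j i)]
    ring
  simp_rw [hsplit, Finset.sum_add_distrib]
  rw [hsym]
  ring

end QuadraticForm

/-! ### The long-run covariance matrix is positive semidefinite -/

section Matrix

variable {κ : Kernel Ω Ω} [IsMarkovKernel κ] {π : Measure Ω} [IsProbabilityMeasure π] {A ρ : ℝ}

/-- **`σ²_{Σ t_i f_i} = t ⬝ᵥ Σ *ᵥ t`** with `Σ = Matrix.of (i, j ↦ σ_{f_i f_j})`. -/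
theorem greenKubo_finset_sum_eq_dotProduct_of_envelope
    (henv : ∀ (g : Ω → ℝ), Measurable g → ∀ (Cg : ℝ), (∀ x, |g x| ≤ Cg) →
      ∀ (t : ℕ) (x : Ω), |(kop κ)^[t] g x - ∫ y, g y ∂π| ≤ 2 * Cg * (A * ρ ^ t))
    (hρ0 : 0 ≤ ρ) (hρ1 : ρ < 1) {f : ι → Ω → ℝ} (hf : ∀ i, Measurable (f i)) {C : ℝ}
    (hC : ∀ i x, |f i x| ≤ C) (t : ι → ℝ) :
    ((∫ y, ((∑ i, t i * f i y) - ∫ z, (∑ i, t i * f i z) ∂π) ^ 2 ∂π)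
        + 2 * ∑' k, ∫ y, ((∑ i, t i * f i y) - ∫ z, (∑ i, t i * f i z) ∂π)
          * (kop κ)^[k + 1] (fun y => (∑ i, t i * f i y) - ∫ z, (∑ i, t i * f i z) ∂π) y ∂π)
      = t ⬝ᵥ ((Matrix.of fun i j : ι =>
      ((∫ y, (f i y - ∫ z, f i z ∂π) * (f j y - ∫ z, f j z ∂π) ∂π)
            + ∑' k, ((∫ y, (f i y - ∫ z, f i z ∂π)
                * (kop κ)^[k + 1] (fun y => f j y - ∫ z, f j z ∂π) y ∂π)
              + ∫ y, (f j y - ∫ z, f j z ∂π)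
                  * (kop κ)^[k + 1] (fun y => f i y - ∫ z, f i z ∂π) y ∂π))) *ᵥ t) := by
  rw [greenKubo_finset_sum_eq_of_envelope henv hρ0 hρ1 hf hC t]
  simp only [dotProduct, Matrix.mulVec, Matrix.of_apply, Finset.mul_sum]
  exact Finset.sum_congr rfl fun i _ => Finset.sum_congr rfl fun j _ => by ring

/-- **THE LONG-RUN COVARIANCE MATRIX IS POSITIVE SEMIDEFINITE** (`π` invariant, the envelope with
`0 ≤ ρ < 1`, `f_i` measurable with a common bound). -/
theorem longRunCovMatrix_posSemidef_of_envelope (hπ : Kernel.Invariant κ π)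
    (henv : ∀ (g : Ω → ℝ), Measurable g → ∀ (Cg : ℝ), (∀ x, |g x| ≤ Cg) →
      ∀ (t : ℕ) (x : Ω), |(kop κ)^[t] g x - ∫ y, g y ∂π| ≤ 2 * Cg * (A * ρ ^ t))
    (hρ0 : 0 ≤ ρ) (hρ1 : ρ < 1) {f : ι → Ω → ℝ} (hf : ∀ i, Measurable (f i)) {C : ℝ}
    (hC : ∀ i x, |f i x| ≤ C) :
    (Matrix.of fun i j : ι =>
      ((∫ y, (f i y - ∫ z, f i z ∂π) * (f j y - ∫ z, f j z ∂π) ∂π)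
            + ∑' k, ((∫ y, (f i y - ∫ z, f i z ∂π)
                * (kop κ)^[k + 1] (fun y => f j y - ∫ z, f j z ∂π) y ∂π)
              + ∫ y, (f j y - ∫ z, f j z ∂π)
                  * (kop κ)^[k + 1] (fun y => f i y - ∫ z, f i z ∂π) y ∂π))).PosSemidef := by
  refine Matrix.PosSemidef.of_dotProduct_mulVec_nonneg ?_ fun t => ?_
  · -- symmetric
    refine Matrix.IsHermitian.ext fun i j => ?_
    simp only [Matrix.of_apply, star_trivial]
    have hs : ∀ i j, Summable fun k : ℕ => ∫ y, (f i y - ∫ z, f i z ∂π)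
        * (kop κ)^[k + 1] (fun y => f j y - ∫ z, f j z ∂π) y ∂π := fun i j =>
      summable_crossAutocov_of_envelope henv hρ0 hρ1 (hf i) (hf j) (hC i) (hC j)
    rw [(hs j i).tsum_add (hs i j), (hs i j).tsum_add (hs j i), add_comm (∑' k, _),
      integral_congr_ae (ae_of_all _ fun y => mul_comm _ _)]
  · -- nonnegative quadratic form = a Green–Kubo variance
    rw [star_trivial, ← greenKubo_finset_sum_eq_dotProduct_of_envelope henv hρ0 hρ1 hf hC t]
    have hm : Measurable fun y => ∑ i, t i * f i y :=
      Finset.measurable_sum _ fun i _ => (hf i).const_mul _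
    have hb : ∀ y, |∑ i, t i * f i y| ≤ ∑ i, |t i| * |C| := fun y =>
      (Finset.abs_sum_le_sum_abs _ _).trans (Finset.sum_le_sum fun i _ => by
        rw [abs_mul]
        exact mul_le_mul_of_nonneg_left ((hC i y).trans (le_abs_self C)) (abs_nonneg _))
    exact greenKubo_nonneg_of_envelope hπ henv hρ0 hρ1 hm hb

end Matrix

/-! ### The multivariate Gaussian limit and the CLT -/

section CLT

variable [DecidableEq ι]

/-- Under `multivariateGaussian 0 S` (`S` positive semidefinite) the functional `⟪t, ·⟫` is
`N(0, t ⬝ᵥ S *ᵥ t)`. -/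
theorem hasLaw_inner_multivariateGaussian_dotProduct {S : Matrix ι ι ℝ} (hS : S.PosSemidef)
    (t : EuclideanSpace ℝ ι) :
    HasLaw (fun z : EuclideanSpace ℝ ι => ⟪t, z⟫) (gaussianReal 0 (Real.toNNReal (t ⬝ᵥ (S *ᵥ t))))
      (multivariateGaussian 0 S) := by
  have h := CardConsistency.hasLaw_inner_of_isGaussian (ν := multivariateGaussian 0 S)
    (Z := fun z : EuclideanSpace ℝ ι => z) ⟨aemeasurable_id, Measure.map_id⟩ t
  have hmean : (multivariateGaussian 0 S)[fun x : EuclideanSpace ℝ ι => ⟪t, x⟫] = 0 := by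
    have hi : ∫ x, ⟪t, x⟫ ∂(multivariateGaussian 0 S) = ⟪t, ∫ x, x ∂(multivariateGaussian 0 S)⟫ :=
      integral_inner (IsGaussian.integrable_id) t
    show ∫ x, ⟪t, x⟫ ∂(multivariateGaussian 0 S) = 0
    rw [hi, integral_id_multivariateGaussian, inner_zero_right]
  have hvar : Var[fun x : EuclideanSpace ℝ ι => ⟪t, x⟫; multivariateGaussian 0 S]
      = t ⬝ᵥ (S *ᵥ t) := by
    rw [← covarianceBilin_self IsGaussian.memLp_two_id, covarianceBilin_multivariateGaussian hS]
  rw [hmean, hvar] at h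
  exact h

variable {κ : Kernel Ω Ω} [IsMarkovKernel κ] {ν : Measure Ω} [IsProbabilityMeasure ν] {ε : ℝ≥0∞}
  {m : ℕ}

omit [DecidableEq ι] in
/-- `⟪t, toLp 2 v⟫ = Σ_i t_i v_i` in `EuclideanSpace ℝ ι`. -/
theorem inner_toLp_euclidean (t : EuclideanSpace ℝ ι) (v : ι → ℝ) :
    ⟪t, toLp 2 v⟫ = ∑ i, t i * v i := by
  simp [PiLp.inner_apply, mul_comm]

/-- **THE MULTIVARIATE MARKOV-CHAIN CLT, FROM ANY INITIAL LAW.**  `π` invariant,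
`(nHit κ m)(z,·) ≥ ε ν` (`0 < ε ≤ 1`, `0 < m`), `f : ι → (Ω → ℝ)` measurable with a common bound,
`Σ = Matrix.of (i, j ↦ σ_{f_i f_j})`.  Then for every initial law `μ₀`:
`(toLp 2 (i ↦ (√n)⁻¹ Σ_{s<n} (f_i(x_s) − πf_i))) ⇒ multivariateGaussian 0 Σ`
in `EuclideanSpace ℝ ι`. -/
theorem chain_multivariate_clt_of_nHit {π : Measure Ω} [IsProbabilityMeasure π]
    (hπ : Kernel.Invariant κ π) (hmin : ∀ z, ε • ν ≤ Exactness.nHit κ m z) (hε0 : 0 < ε)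
    (hε1 : ε ≤ 1) (hm : 0 < m)
    {f : ι → Ω → ℝ} (hf : ∀ i, Measurable (f i)) {C : ℝ} (hC : ∀ i x, |f i x| ≤ C)
    (μ₀ : Measure Ω) [IsProbabilityMeasure μ₀]
    [IsProbabilityMeasure (Kernel.trajMeasure (X := fun _ : ℕ => Ω) μ₀
          (fun n : ℕ => κ.comap (fun h : (i : ↥(Finset.Iic n)) → Ω => h ⟨n, Finset.mem_Iic.2 le_rfl⟩)
            (measurable_pi_apply _)))] :
    TendstoInDistribution (fun (n : ℕ) (x : ℕ → Ω) =>
        toLp 2 (fun i => (Real.sqrt n)⁻¹ * ∑ s ∈ Finset.range n, (f i (x s) - ∫ z, f i z ∂π)))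
      atTop (fun z : EuclideanSpace ℝ ι => z) (fun _ => (Kernel.trajMeasure (X := fun _ : ℕ => Ω) μ₀
          (fun n : ℕ => κ.comap (fun h : (i : ↥(Finset.Iic n)) → Ω => h ⟨n, Finset.mem_Iic.2 le_rfl⟩)
            (measurable_pi_apply _))))
      (multivariateGaussian 0 (Matrix.of fun i j : ι =>
      ((∫ y, (f i y - ∫ z, f i z ∂π) * (f j y - ∫ z, f j z ∂π) ∂π)
            + ∑' k, ((∫ y, (f i y - ∫ z, f i z ∂π)
                * (kop κ)^[k + 1] (fun y => f j y - ∫ z, f j z ∂π) y ∂π)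
              + ∫ y, (f j y - ∫ z, f j z ∂π)
                  * (kop κ)^[k + 1] (fun y => f i y - ∫ z, f i z ∂π) y ∂π)))) := by
  obtain ⟨A, ρ, -, hρ0, hρ1, henv⟩ := exists_geometricEnvelope_of_nHit
    (Exactness.GeneralNCMC.minorised_setwise hmin) hε0 hε1 hm hπ
  have hS := longRunCovMatrix_posSemidef_of_envelope hπ henv hρ0 hρ1 hf hC
  have hfb : ∀ i, Measurable (fun y => f i y - ∫ z, f i z ∂π) := fun i =>
    (centred_observable_bounds π (hf i) (hC i)).1
  have hXm : ∀ n : ℕ, Measurable fun x : ℕ → Ω =>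
      toLp 2 (fun i => (Real.sqrt n)⁻¹ * ∑ s ∈ Finset.range n, (f i (x s) - ∫ z, f i z ∂π)) :=
    fun n => (measurable_toLp 2 (ι → ℝ)).comp (measurable_pi_lambda _ fun i =>
      measurable_const.mul (Finset.measurable_sum _ fun s _ =>
        (hfb i).comp (measurable_pi_apply s)))
  refine CardConsistency.tendstoInDistribution_of_forall_inner (fun n => (hXm n).aemeasurable)
    aemeasurable_id fun t => ?_
  -- the functional `⟪t, ·⟫` of the vector is the scaled sum of the observable `Σ_i t_i f_i`
  have hm' : Measurable fun y => ∑ i, t i * f i y :=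
    Finset.measurable_sum _ fun i _ => (hf i).const_mul _
  have hb' : ∀ y, |∑ i, t i * f i y| ≤ ∑ i, |t i| * |C| := fun y =>
    (Finset.abs_sum_le_sum_abs _ _).trans (Finset.sum_le_sum fun i _ => by
      rw [abs_mul]; exact mul_le_mul_of_nonneg_left ((hC i y).trans (le_abs_self C)) (abs_nonneg _))
  have hY := hasLaw_inner_multivariateGaussian_dotProduct hS t
  rw [← greenKubo_finset_sum_eq_dotProduct_of_envelope henv hρ0 hρ1 hf hC] at hY
  have hclt := Exactness.GeneralNCMC.tendstoInDistribution_timeAverage_of_nHit hπ hε0.ne' hmin hm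
    hm' hb' μ₀ hY
  have hch : ∫ z, (∑ i, t i * f i z) ∂π = ∑ i, t i * ∫ z, f i z ∂π := by
    rw [integral_finsetSum _ fun i _ => (integrable_of_bounded π (hf i) (hC i)).const_mul _]
    exact Finset.sum_congr rfl fun i _ => integral_const_mul _ _
  refine hclt.congr (fun n => Eventually.of_forall fun x => ?_) EventuallyEq.rfl
  show (Real.sqrt n)⁻¹ * ∑ s ∈ Finset.range n, ((∑ i, t i * f i (x s)) - ∫ z, (∑ i, t i * f i z) ∂π)
    = ⟪t, toLp 2 (fun i => (Real.sqrt n)⁻¹ * ∑ s ∈ Finset.range n, (f i (x s) - ∫ z, f i z ∂π))⟫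
  rw [inner_toLp_euclidean, hch]
  have e : ∀ s, (∑ i, t i * f i (x s)) - ∑ i, t i * ∫ z, f i z ∂π
      = ∑ i, t i * (f i (x s) - ∫ z, f i z ∂π) := fun s => by
    rw [← Finset.sum_sub_distrib]; exact Finset.sum_congr rfl fun i _ => by ring
  simp_rw [e]
  rw [Finset.sum_comm, Finset.mul_sum]
  exact Finset.sum_congr rfl fun i _ => by
    rw [Finset.mul_sum, Finset.mul_sum, Finset.mul_sum]
    exact Finset.sum_congr rfl fun s _ => by ring

end CLT

end Summit.Ventures.LatticeQCDFlow.Scoring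

end
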